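import Literature.Analysis.FluidPDE.NSFourierSynthesis
import Literature.Analysis.FluidPDE.NSRegFourierFamily
import HarnessLib

/-!
# Space-time smoothness of fields synthesized from square-dominated Fourier families

Seventh file of the Fourier-side construction of the global regular solution of the
Leray-regularised Navier–Stokes system (discharge of
`Literature.Analysis.FluidPDE.leray_regularised_wellposed`): the synthesis theorem of
`NSFourierSynthesis` (`(t, x) ↦ 𝓕 (W₀ t) x` is jointly `Cⁿ` on `[0, T] × E` for a Fourier family
of order `n`) for the **square-dominated** families `IsDomFamily` of `NSRegFourierFamily` — the
families available for `L²` data. The proofs are those of `NSFourierSynthesis` (continuity and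
differentiation under the integral sign, induction on the order), the pointwise decay constants
being replaced by the integrable dominators `IsDomFamily.dom_L1`; the generic derivative
computations (`charDeriv`, `synthDerivCLM`, `hasFDerivAt_char_mul`) are reused from the tree
(Leray 1934, §19, pp. 220–221; Ożański–Pooley 2018, Cor. 6.16/6.25).

* `IsDomFamily.dmul`, `continuousOn_synth_dom`, `hasFDerivWithinAt_synth_dom`,
  `contDiffOn_synth_dom`, `contDiffOn_synth_infty_dom`, `hasDerivWithinAt_synth_time_dom`.

## References

* J. Leray, Acta Math. 63 (1934), §8 and §19, pp. 220–221. [Leray1934]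
* W. S. Ożański, B. C. Pooley, LMS Lecture Note Ser. 452 (2018), Cor. 6.16, Def. 6.20, Cor. 6.25. [OzanskiPooley2018]
-/

noncomputable section

open MeasureTheory Real Set Filter Topology Function Complex
open scoped FourierTransform RealInnerProductSpace ContDiff

namespace Literature.Analysis.FluidPDE.FourierNS

variable {ι : Type*} [Fintype ι]

variable {T : ℝ} {n : ℕ} {W : ℕ → ℝ → EuclideanSpace ℝ ι → ℂ}

/-- The space-derivative family of a square-dominated family is square-dominated. [folklore] -/
theorem IsDomFamily.dmul (hW : IsDomFamily T n W) (h : EuclideanSpace ℝ ι) : IsDomFamily T n (dmul h W) :=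
  hW.symbol (m := fun ξ => -(2 * π * I) * (⟪ξ, h⟫ : ℂ))
    (by fun_prop : Continuous fun ξ : EuclideanSpace ℝ ι => -(2 * π * I) * (⟪ξ, h⟫ : ℂ)).aestronglyMeasurable
    (d := 1) (M := 2 * π * ‖h‖) (by positivity) (norm_dmulSymbol_le h)

/-! ### Continuity on the slab -/

/-- **Joint continuity** of the synthesized field on the closed slab `[0, T] × E` for a
square-dominated family (dominated convergence with an integrable dominator of order `0`). [folklore] -/
theorem continuousOn_synth_dom (hT : 0 ≤ T) (hW : IsDomFamily T n W) : ContinuousOn (synth W) (Icc 0 T ×ˢ univ) := by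
  obtain ⟨g, hg, -, hle⟩ := hW.dom_L1 hT (Nat.zero_le _) 0
  have hsynth : synth W = fun z => ∫ ξ, 𝐞 (-⟪ξ, z.2⟫) • W 0 z.1 ξ := funext (synth_eq W)
  rw [hsynth]
  refine continuousOn_of_dominated (bound := g) ?_ ?_ hg ?_
  · intro z hz
    exact (Continuous.aestronglyMeasurable (by fun_prop)).smul (hW.meas 0 (Nat.zero_le _) z.1 hz.1)
  · intro z hz
    refine Eventually.of_forall fun ξ => ?_
    rw [Circle.norm_smul]
    simpa using hle z.1 hz.1 ξ
  · refine Eventually.of_forall fun ξ => ?_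
    have h1 : Continuous fun z : ℝ × EuclideanSpace ℝ ι => (𝐞 (-⟪ξ, z.2⟫) : ℂ) := by fun_prop
    have h2 : ContinuousOn (fun z : ℝ × EuclideanSpace ℝ ι => W 0 z.1 ξ) (Icc 0 T ×ˢ univ) :=
      (hW.cont 0 (Nat.zero_le _) ξ).comp continuous_fst.continuousOn fun z hz => hz.1
    simp only [Circle.smul_def, smul_eq_mul]
    exact h1.continuousOn.mul h2

/-! ### The joint derivative within the slab -/

-- the dominated-differentiation step elaborates many continuous-linear-map coercions
set_option maxHeartbeats 800000 in
/-- **The joint derivative within the slab** for a square-dominated family of order `≥ 1`: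
at `z = (t, x) ∈ [0, T] × E` the synthesized field has, within the slab, the Fréchet derivative
`L = ∫ synthDerivCLM (𝐞(-⟪ξ,x⟫)) (W₀ t ξ) (W₁ t ξ) ξ x dξ`, and
`L y = y.1 • synth (W₁, …) z + synth (dmul y.2 W) z`. [folklore] -/
theorem hasFDerivWithinAt_synth_dom (hT : 0 < T) (hW : IsDomFamily T (n + 1) W)
    {z : ℝ × EuclideanSpace ℝ ι} (hz : z ∈ Icc 0 T ×ˢ univ) :
    ∃ L : ℝ × EuclideanSpace ℝ ι →L[ℝ] ℂ,
      HasFDerivWithinAt (synth W) L (Icc 0 T ×ˢ univ) z ∧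
      ∀ y, L y = (y.1 : ℂ) * synth (fun k => W (k + 1)) z + synth (dmul y.2 W) z := by
  have ht₀ : z.1 ∈ Icc 0 T := hz.1
  have h0 : 0 ≤ n + 1 := Nat.zero_le _
  have h1 : 1 ≤ n + 1 := by omega
  -- integrable dominators (orders `0` and `1`) of `W₀`, `W₁` on `[0, T]`
  obtain ⟨g₀, hg₀, hg₀0, hg₀le⟩ := hW.dom_L1 hT.le h0 1
  obtain ⟨g₁, hg₁, hg₁0, hg₁le⟩ := hW.dom_L1 hT.le h1 1
  -- the extended coefficient and its time derivative
  set Wt : ℝ → EuclideanSpace ℝ ι → ℂ := fun t ξ => icExtend T (W 0 · ξ) (W 1 · ξ) t with hWt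
  set Wt' : ℝ → EuclideanSpace ℝ ι → ℂ := fun t ξ => W 1 (clamp T t) ξ with hWt'
  have hWt_deriv : ∀ ξ t, HasDerivAt (Wt · ξ) (Wt' t ξ) t := fun ξ t =>
    hasDerivAt_icExtend hT (fun s hs => by simpa using hW.deriv 0 (by omega) ξ s hs) t
  set F : ℝ × EuclideanSpace ℝ ι → EuclideanSpace ℝ ι → ℂ :=
    fun zz ξ => (𝐞 (-⟪ξ, zz.2⟫) : ℂ) * Wt zz.1 ξ with hF
  set F' : ℝ × EuclideanSpace ℝ ι → EuclideanSpace ℝ ι → (ℝ × EuclideanSpace ℝ ι →L[ℝ] ℂ) :=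
    fun zz ξ => synthDerivCLM (𝐞 (-⟪ξ, zz.2⟫)) (Wt zz.1 ξ) (Wt' zz.1 ξ) ξ zz.2 with hF'
  have hF_diff : ∀ ξ zz, HasFDerivAt (F · ξ) (F' zz ξ) zz := fun ξ zz =>
    hasFDerivAt_char_mul ξ zz (hWt_deriv ξ zz.1)
  have hWt_eq : ∀ t, (fun ξ => Wt t ξ) = W 0 (clamp T t) + (t - clamp T t) • W 1 (clamp T t) := fun t => rfl
  have hWt_meas : ∀ t, AEStronglyMeasurable (fun ξ => Wt t ξ) volume := fun t => by
    rw [hWt_eq]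
    exact (hW.meas 0 h0 _ (clamp_mem_Icc hT.le t)).add ((hW.meas 1 h1 _ (clamp_mem_Icc hT.le t)).const_smul _)
  have hWt'_meas : ∀ t, AEStronglyMeasurable (fun ξ => Wt' t ξ) volume := fun t =>
    hW.meas 1 h1 _ (clamp_mem_Icc hT.le t)
  have hchar_cont : ∀ x : EuclideanSpace ℝ ι, Continuous fun ξ : EuclideanSpace ℝ ι => (𝐞 (-⟪ξ, x⟫) : ℂ) :=
    fun x => by fun_prop
  have hF_meas : ∀ zz, AEStronglyMeasurable (F zz) volume := fun zz =>
    (hchar_cont zz.2).aestronglyMeasurable.mul (hWt_meas zz.1)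
  have hF'_meas : ∀ zz, AEStronglyMeasurable (F' zz) volume := by
    intro zz
    simp only [hF', synthDerivCLM]
    refine AEStronglyMeasurable.add ?_ ?_
    · have hsm : Continuous fun w : ℂ => (ContinuousLinearMap.fst ℝ ℝ (EuclideanSpace ℝ ι)).smulRight w :=
        (ContinuousLinearMap.smulRightL ℝ (ℝ × EuclideanSpace ℝ ι) ℂ
          (ContinuousLinearMap.fst ℝ ℝ (EuclideanSpace ℝ ι))).continuous
      exact hsm.comp_aestronglyMeasurable ((hchar_cont zz.2).aestronglyMeasurable.mul (hWt'_meas zz.1))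
    · exact (hWt_meas zz.1).smul (((ContinuousLinearMap.compL ℝ (ℝ × EuclideanSpace ℝ ι)
        (EuclideanSpace ℝ ι) ℂ).flip (ContinuousLinearMap.snd ℝ ℝ (EuclideanSpace ℝ ι))).continuous.comp
          (continuous_charDeriv zz.2)).aestronglyMeasurable
  -- integrability at `z`
  have hFz : F z = fun ξ => (𝐞 (-⟪ξ, z.2⟫) : ℂ) * W 0 z.1 ξ := by
    funext ξ; simp only [hF, hWt, icExtend_of_mem ht₀]
  have hF_int : Integrable (F z) := by
    rw [hFz]
    refine (hW.integrable h0 ht₀).norm.mono' (hF_meas z |>.congr (Eventually.of_forall fun ξ => by simp only [hFz])) ?_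
    exact Eventually.of_forall fun ξ => by rw [norm_mul, Circle.norm_coe, one_mul]
  -- the dominating function on the unit ball around `z`
  set bound : EuclideanSpace ℝ ι → ℝ := fun ξ => g₁ ξ + 2 * π * (g₀ ξ + g₁ ξ) with hbound
  have hbound_int : Integrable bound := hg₁.add ((hg₀.add hg₁).const_mul _)
  have h_bound : ∀ᵐ ξ ∂volume, ∀ zz ∈ Metric.ball z 1, ‖F' zz ξ‖ ≤ bound ξ := by
    refine Eventually.of_forall fun ξ zz hzz => ?_
    have hcl := clamp_mem_Icc hT.le zz.1
    have hdt : |zz.1 - clamp T zz.1| ≤ 1 := by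
      refine (abs_sub_clamp_le hT.le ht₀).trans ?_
      have : dist zz.1 z.1 ≤ dist zz z := by
        rw [dist_eq_norm, dist_eq_norm]
        exact norm_fst_le (zz - z)
      rw [Real.dist_eq] at this
      exact this.trans (Metric.mem_ball.1 hzz).le
    have hw1 : ∀ {k : ℕ} {g : EuclideanSpace ℝ ι → ℝ}, (∀ t ∈ Icc 0 T, ∀ ξ, (1 + ‖ξ‖) ^ 1 * ‖W k t ξ‖ ≤ g ξ) →
        ∀ t ∈ Icc 0 T, ‖W k t ξ‖ ≤ g ξ ∧ ‖ξ‖ * ‖W k t ξ‖ ≤ g ξ := by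
      intro k g hg t ht
      have h := hg t ht ξ
      rw [pow_one] at h
      have hn := norm_nonneg (W k t ξ)
      constructor <;> nlinarith [norm_nonneg ξ]
    have hWt'_le : ‖Wt' zz.1 ξ‖ ≤ g₁ ξ := (hw1 hg₁le _ hcl).1
    have hWt_le : ‖ξ‖ * ‖Wt zz.1 ξ‖ ≤ g₀ ξ + g₁ ξ := by
      have e1 : ‖Wt zz.1 ξ‖ ≤ ‖W 0 (clamp T zz.1) ξ‖ + ‖W 1 (clamp T zz.1) ξ‖ := by
        change ‖W 0 (clamp T zz.1) ξ + (zz.1 - clamp T zz.1) • W 1 (clamp T zz.1) ξ‖ ≤ _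
        refine (norm_add_le _ _).trans (add_le_add le_rfl ?_)
        rw [norm_smul, Real.norm_eq_abs]
        exact mul_le_of_le_one_left (norm_nonneg _) hdt
      calc ‖ξ‖ * ‖Wt zz.1 ξ‖ ≤ ‖ξ‖ * (‖W 0 (clamp T zz.1) ξ‖ + ‖W 1 (clamp T zz.1) ξ‖) :=
            mul_le_mul_of_nonneg_left e1 (norm_nonneg _)
        _ = ‖ξ‖ * ‖W 0 (clamp T zz.1) ξ‖ + ‖ξ‖ * ‖W 1 (clamp T zz.1) ξ‖ := by ring
        _ ≤ g₀ ξ + g₁ ξ := add_le_add (hw1 hg₀le _ hcl).2 (hw1 hg₁le _ hcl).2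
    calc ‖F' zz ξ‖ ≤ ‖Wt' zz.1 ξ‖ + 2 * π * ‖ξ‖ * ‖Wt zz.1 ξ‖ := norm_synthDerivCLM_le (Circle.norm_coe _) ξ zz.2
      _ = ‖Wt' zz.1 ξ‖ + 2 * π * (‖ξ‖ * ‖Wt zz.1 ξ‖) := by ring
      _ ≤ g₁ ξ + 2 * π * (g₀ ξ + g₁ ξ) := by gcongr
      _ = bound ξ := rfl
  have hmain := hasFDerivAt_integral_of_dominated_of_fderiv_le (μ := (volume : Measure (EuclideanSpace ℝ ι)))
    (F := F) (F' := F') (x₀ := z) (s := Metric.ball z 1) (Metric.ball_mem_nhds z one_pos)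
    (Eventually.of_forall hF_meas) hF_int (hF'_meas z) h_bound hbound_int
    (Eventually.of_forall fun ξ zz _ => hF_diff ξ zz)
  have hF'_int : Integrable (F' z) :=
    hbound_int.mono' (hF'_meas z) (h_bound.mono fun ξ hξ => hξ z (Metric.mem_ball_self one_pos))
  refine ⟨∫ ξ, F' z ξ, ?_, fun y => ?_⟩
  · refine hmain.hasFDerivWithinAt.congr (fun zz hzz => ?_) ?_
    · rw [synth_eq]
      refine integral_congr_ae (Eventually.of_forall fun ξ => ?_)
      simp only [hF, hWt, icExtend_of_mem (show zz.1 ∈ Icc 0 T from hzz.1), Circle.smul_def, smul_eq_mul]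
    · rw [synth_eq]
      refine integral_congr_ae (Eventually.of_forall fun ξ => ?_)
      simp only [hF, hWt, icExtend_of_mem ht₀, Circle.smul_def, smul_eq_mul]
  · rw [ContinuousLinearMap.integral_apply hF'_int y, synth_eq, synth_eq]
    have hWt_z : ∀ ξ, Wt z.1 ξ = W 0 z.1 ξ := fun ξ => by simp only [hWt, icExtend_of_mem ht₀]
    have hWt'_z : ∀ ξ, Wt' z.1 ξ = W 1 z.1 ξ := fun ξ => by simp only [hWt', clamp_of_mem ht₀]
    have hi1 : Integrable fun ξ => 𝐞 (-⟪ξ, z.2⟫) • W (0 + 1) z.1 ξ := by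
      refine (hW.integrable h1 ht₀).norm.mono' ((hchar_cont z.2).aestronglyMeasurable.smul (hW.meas 1 h1 z.1 ht₀)) ?_
      exact Eventually.of_forall fun ξ => by rw [Circle.norm_smul]
    have hdm := hW.dmul y.2
    have hi2 : Integrable fun ξ => 𝐞 (-⟪ξ, z.2⟫) • FourierNS.dmul y.2 W 0 z.1 ξ := by
      refine (hdm.integrable h0 ht₀).norm.mono' ((hchar_cont z.2).aestronglyMeasurable.smul (hdm.meas 0 h0 z.1 ht₀)) ?_
      exact Eventually.of_forall fun ξ => by rw [Circle.norm_smul]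
    rw [← integral_const_mul, ← integral_add (hi1.const_mul _) hi2]
    refine integral_congr_ae (Eventually.of_forall fun ξ => ?_)
    simp only [hF', synthDerivCLM_apply, hWt_z, hWt'_z, charDeriv_apply, FourierNS.dmul, Circle.smul_def, smul_eq_mul,
      zero_add]
    ring

/-! ### Smoothness by induction on the order -/

/-- The directional derivatives within the slab are synthesized fields. [folklore] -/
theorem fderivWithin_synth_apply_dom (hT : 0 < T) (hW : IsDomFamily T (n + 1) W) {z : ℝ × EuclideanSpace ℝ ι}
    (hz : z ∈ Icc 0 T ×ˢ univ) (y : ℝ × EuclideanSpace ℝ ι) :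
    fderivWithin ℝ (synth W) (Icc 0 T ×ˢ univ) z y = (y.1 : ℂ) * synth (fun k => W (k + 1)) z + synth (dmul y.2 W) z := by
  obtain ⟨L, hL, hLy⟩ := hasFDerivWithinAt_synth_dom hT hW hz
  rw [hL.fderivWithin (uniqueDiffOn_slab hT z hz), hLy]

/-- Differentiability of the synthesized field on the slab for square-dominated families of order `≥ 1`. [folklore] -/
theorem differentiableOn_synth_dom (hT : 0 < T) (hW : IsDomFamily T (n + 1) W) :
    DifferentiableOn ℝ (synth W) (Icc 0 T ×ˢ univ) := fun _ hz =>
  (hasFDerivWithinAt_synth_dom hT hW hz).choose_spec.1.differentiableWithinAt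

/-- **Joint `C^n` smoothness of the synthesized field on the closed slab**, for every
square-dominated family of order `n` (induction on `n`). [folklore] -/
theorem contDiffOn_synth_dom (hT : 0 < T) :
    ∀ (n : ℕ) (W : ℕ → ℝ → EuclideanSpace ℝ ι → ℂ), IsDomFamily T n W → ContDiffOn ℝ n (synth W) (Icc 0 T ×ˢ univ) := by
  intro n
  induction n with
  | zero =>
    intro W hW
    rw [Nat.cast_zero, contDiffOn_zero]
    exact continuousOn_synth_dom hT.le hW
  | succ n ih =>
    intro W hW
    rw [Nat.cast_succ]
    refine contDiffOn_succ_of_fderiv_apply (differentiableOn_synth_dom hT hW) (fun h => ?_) fun y => ?_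
    · exact absurd h (by simp)
    · have h1 : ContDiffOn ℝ n (synth (fun k => W (k + 1))) (Icc 0 T ×ˢ univ) := ih _ hW.shift
      have h2 : ContDiffOn ℝ n (synth (dmul y.2 W)) (Icc 0 T ×ˢ univ) := ih _ ((hW.dmul y.2).mono (Nat.le_succ n))
      have h3 : ContDiffOn ℝ n (fun z => (y.1 : ℂ) * synth (fun k => W (k + 1)) z + synth (dmul y.2 W) z)
          (Icc 0 T ×ˢ univ) := (contDiffOn_const.mul h1).add h2
      exact h3.congr fun z hz => fderivWithin_synth_apply_dom hT hW hz y

/-- **`C^∞` smoothness**: if `W₀` is the zeroth member of a square-dominated family of every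
order, then `(t, x) ↦ 𝓕 (W₀ t) x` is `C^∞` on the closed slab. [folklore] -/
theorem contDiffOn_synth_infty_dom (hT : 0 < T) {W₀ : ℝ → EuclideanSpace ℝ ι → ℂ}
    (hall : ∀ n : ℕ, ∃ W : ℕ → ℝ → EuclideanSpace ℝ ι → ℂ, W 0 = W₀ ∧ IsDomFamily T n W) :
    ContDiffOn ℝ ∞ (fun z : ℝ × EuclideanSpace ℝ ι => 𝓕 (W₀ z.1) z.2) (Icc 0 T ×ˢ univ) := by
  rw [contDiffOn_infty]
  intro n
  obtain ⟨W, hW0, hW⟩ := hall n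
  have h1 := contDiffOn_synth_dom hT n W hW
  have h2 : synth W = fun z : ℝ × EuclideanSpace ℝ ι => 𝓕 (W₀ z.1) z.2 := by
    funext z; rw [synth, hW0]
  rw [h2] at h1
  exact h1

/-- **The time derivative within `[0, T]`** of the synthesized field at a fixed point `x`:
`∂ₜ synth W (t, x) = synth (W₁, …) (t, x)`. [folklore] -/
theorem hasDerivWithinAt_synth_time_dom (hT : 0 < T) (hW : IsDomFamily T (n + 1) W) (x : EuclideanSpace ℝ ι) {t : ℝ}
    (ht : t ∈ Icc 0 T) :
    HasDerivWithinAt (fun s => synth W (s, x)) (synth (fun k => W (k + 1)) (t, x)) (Icc 0 T) t := by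
  have hz : ((t, x) : ℝ × EuclideanSpace ℝ ι) ∈ Icc 0 T ×ˢ (univ : Set (EuclideanSpace ℝ ι)) := mk_mem_prod ht (mem_univ x)
  obtain ⟨L, hL, hLy⟩ := hasFDerivWithinAt_synth_dom hT hW hz
  have hγ : HasDerivWithinAt (fun s : ℝ => ((s, x) : ℝ × EuclideanSpace ℝ ι)) ((1, 0) : ℝ × EuclideanSpace ℝ ι) (Icc 0 T) t :=
    (hasDerivWithinAt_id t _).prodMk (hasDerivWithinAt_const _ _ _)
  have h := hL.comp_hasDerivWithinAt t hγ (fun s hs => mk_mem_prod hs (mem_univ _))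
  have hval : L (1, 0) = synth (fun k => W (k + 1)) (t, x) := by
    rw [hLy]; simp [synth_dmul_zero]
  rw [hval] at h
  exact h

end Literature.Analysis.FluidPDE.FourierNS

end
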